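import Summits.FinalStateConjecture.FinalStateConjecture.Theses.LaminatedThreshold
import Literature.Geometry.Lorentzian.ExactKerrEnd
import Literature.Geometry.Lorentzian.TameFamilyFarSurgery

/-!
# Crux-strategist sketch for `LaminatedThreshold.TameExitsLocalise` (stmt-FinalStateConjecture-16894)

planner-cstrat-stmt-FinalStateConjecture-16894-b1-0 · 2026-08-17.

Contents (all `sorry`-free; the open statements are `def … : Prop`, never asserted):

* §1 Vocabulary: `Good`, `TameGoodExit`, `LocalExitWindow`, `LocallyIncurable`, `TailSmooth`;
  `tameExitsLocalise_iff` — the crux is DEFINITIONALLY `∀ X d⋆ ∈ 𝓓, ¬ Good d⋆ → TameGoodExit d⋆ → LocalExitWindow d⋆`.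
* §2 NEGATION FRAME (proved): a locally incurable datum has no local exit window and is exceptional, hence
  `not_tameExitsLocalise_of_exists : ExistsIncurableTamelyCurable → ¬ TameExitsLocalise`.
  `ExistsIncurableTamelyCurable` (= "some admissible datum cannot be cured by ANY compactly supported admissible
  surgery but is the base of a tame immersed injective admissible family of good data") is the ONE stub of the
  negation line; the strategist's census (STRATEGY-CENSUS.md §Negation) gives the geometric-optics pulse-train
  recipe for it.
* §3 ROUTE-REPAIR CANDIDATES (signatures + proved comparisons): `TameExitsLocaliseSmooth` (B restricted to
  tail-smooth base data), `TameExitsLocaliseRough`, `tameExitsLocalise_of_smooth_rough` (case split, proved),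
  `TameExitsLocaliseKerrEnded` (B weakened to the Corvino–Schoen class with FLOATING Kerr tails) and
  `kerrEnded_of_tameExitsLocalise : TameExitsLocalise → TameExitsLocaliseKerrEnded` (proved: it IS a weakening).
-/

noncomputable section

set_option linter.dupNamespace false

namespace Summit.FinalStateConjecture.FinalStateConjecture.Cruxes.TameExitsLocalise.Strategist

open scoped Manifold ContDiff Topology
open Literature.Geometry.Lorentzian
open Summit.FinalStateConjecture.FinalStateConjecture.Theses.LaminatedThreshold

/-! ## §1 Vocabulary -/

section Vocabulary

variable {X : Type} [TopologicalSpace X] [ChartedSpace E3 X] [IsManifold (𝓡 3) ∞ X] [T2Space X]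
  [SecondCountableTopology X] [ConnectedSpace X]

/-- **GOOD datum** — verbatim the property whose tame genericity `FinalStateConjecture` asserts. -/
def Good (D : InitialDataSet (𝓡 3) X) : Prop :=
  (∃ 𝒟 : VacuumCauchyDevelopment D, 𝒟.IsMaximal) ∧
    ∀ 𝒟 : VacuumCauchyDevelopment D, 𝒟.IsMaximal →
      Summit.FinalStateConjecture.HasCompleteNullInfinity 𝒟.toCauchyDevelopment ∧
        ∃ (O : Set 𝒟.carrier) (d : FinalStateDecomposition 𝒟.toSpacetime O 2),
          (∀ i, Kerr.IsSubextremal (d.mass i) (d.spin i)) ∧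
            O = Summit.FinalStateConjecture.exteriorOf 𝒟.toCauchyDevelopment d.charted ∧
              Summit.FinalStateConjecture.RaysStayInClosure 𝒟.toCauchyDevelopment O ∧
                Summit.FinalStateConjecture.HasExhaustiveCharts d ∧
                  Summit.FinalStateConjecture.IsFutureOriented d

/-- **Tame good exit at `d⋆`**: the crux's hypothesis (= `FinalStateConjecture` unfolded at an exceptional `d⋆`). -/
def TameGoodExit (dstar : InitialDataSet (𝓡 3) X) : Prop :=
  ∃ (e : AFEnd X) (F : EuclideanSpace ℝ (Fin 1) → InitialDataSet (𝓡 3) X),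
    InitialDataSet.IsTameDataFamily e 1 F ∧ InitialDataSet.IsImmersedAtZero 1 F ∧ F 0 = dstar ∧
    Function.Injective F ∧ (∀ c, F c ∈ admissibleVacuumData X) ∧ ∀ c, c ≠ 0 → Good (F c)

/-- **Local exit window at `d⋆`**: the crux's conclusion (a compactly supported smooth immersed injective admissible
family through `d⋆`, good on a punctured window). -/
def LocalExitWindow (dstar : InitialDataSet (𝓡 3) X) : Prop :=
  ∃ F' : EuclideanSpace ℝ (Fin 1) → InitialDataSet (𝓡 3) X,
    InitialDataSet.IsSmoothDataFamily 1 F' ∧ InitialDataSet.IsImmersedAtZero 1 F' ∧ F' 0 = dstar ∧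
    Function.Injective F' ∧ (∀ c, F' c ∈ admissibleVacuumData X) ∧
    (∃ C : Set X, IsCompact C ∧
      ∀ c, ∀ x ∉ C, (F' c).h.inner x = dstar.h.inner x ∧ (F' c).k x = dstar.k x) ∧
    ∃ ε : ℝ, 0 < ε ∧ ∀ c, c ≠ 0 → ‖c‖ < ε → Good (F' c)

/-- **Locally incurable datum**: EVERY admissible datum agreeing with `d⋆` off some compact set is exceptional —
exceptionality of `d⋆` is certified by its far field alone. (The geometric-optics pulse-train datum of the census is
the intended instance: infinitely many far, late, unshadowable high-curvature foci survive every compact surgery.) -/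
def LocallyIncurable (dstar : InitialDataSet (𝓡 3) X) : Prop :=
  ∀ C : Set X, IsCompact C → ∀ d' ∈ admissibleVacuumData X,
    (∀ x ∉ C, d'.h.inner x = dstar.h.inner x ∧ d'.k x = dstar.k x) → ¬ Good d'

/-- **Tail-smooth on the end `e`**: Dafermos–Rodnianski rates to ALL orders, `h − (1 + 2M/r)δ = o_∞(r⁻¹)`,
`k = o_∞(r⁻²)` (every derivative count). This is the cheapest typed far-field class excluding the geometric-optics
artefact: `|∂ᵐ h| = o(r^{-1-m})` for all `m` forbids focal curvature `≳ 1` from the tail (amplification `≤ r·ω`). -/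
def TailSmooth (e : AFEnd X) (D : InitialDataSet (𝓡 3) X) : Prop :=
  ∃ M : ℝ, ∀ n : ℕ, e.IsStronglyAsymptoticallyFlatWith D M 1 2 n n

/-- A locally incurable admissible datum is exceptional (take `C = ∅`, `d' = d⋆`). -/
theorem LocallyIncurable.not_good {dstar : InitialDataSet (𝓡 3) X} (h : LocallyIncurable dstar)
    (hd : dstar ∈ admissibleVacuumData X) : ¬ Good dstar :=
  h ∅ isCompact_empty dstar hd fun _ _ ↦ ⟨rfl, rfl⟩

/-- A locally incurable datum has no local exit window: every member of a compactly supported admissible family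
through it is exceptional, in particular the member at `c = (ε/2)·e₀`. -/
theorem LocallyIncurable.not_localExitWindow {dstar : InitialDataSet (𝓡 3) X}
    (h : LocallyIncurable dstar) : ¬ LocalExitWindow dstar := by
  rintro ⟨F', -, -, -, -, hadm, ⟨C, hC, hagree⟩, ε, hε, hgood⟩
  set c : EuclideanSpace ℝ (Fin 1) := (ε / 2) • EuclideanSpace.single (0 : Fin 1) (1 : ℝ) with hc
  have hnorm : ‖c‖ = ε / 2 := by
    rw [hc, norm_smul, EuclideanSpace.norm_single, norm_one, mul_one, Real.norm_eq_abs,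
      abs_of_pos (by positivity)]
  have hc0 : c ≠ 0 := by
    intro h0
    rw [h0, norm_zero] at hnorm
    linarith
  have hcε : ‖c‖ < ε := by rw [hnorm]; linarith
  exact h C hC (F' c) (hadm c) (hagree c) (hgood c hc0 hcε)

end Vocabulary

/-- **The crux, folded**: `TameExitsLocalise` is DEFINITIONALLY
`∀ X, ∀ d⋆ ∈ 𝓓, ¬ Good d⋆ → TameGoodExit d⋆ → LocalExitWindow d⋆`. -/
theorem tameExitsLocalise_iff :
    TameExitsLocalise ↔
      ∀ (X : Type) [TopologicalSpace X] [ChartedSpace E3 X] [IsManifold (𝓡 3) ∞ X] [T2Space X]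
        [SecondCountableTopology X] [ConnectedSpace X],
        ∀ dstar ∈ admissibleVacuumData X, ¬ Good dstar → TameGoodExit dstar → LocalExitWindow dstar :=
  Iff.rfl

/-! ## §2 The negation frame (lens `negation`): ONE stub, the rest is logic -/

/-- **NL1 — the single stub of the negation line.** Some admissible datum is LOCALLY INCURABLE (no compactly
supported admissible surgery makes it good) and yet TAMELY CURABLE (it is the base of a tame, immersed, injective,
admissible one-parameter family whose members `c ≠ 0` are good). Census §Negation: the Minkowski-like conformally
flat maximal datum carrying a locally finite train of far, high-frequency, DR-admissible incoming gravitational-wave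
shells (focal curvature `≳ 1` at times `t_n = 0.9 r_n → ∞` in a dense set of directions) is locally incurable by
far-field focal analysis alone, and is tamely curable iff "Minkowski + finitely many admissible geometric-optics
shells settles" (physically immediate; a large-data global statement in print-open form). -/
def ExistsIncurableTamelyCurable : Prop :=
  ∃ (X : Type) (_ : TopologicalSpace X) (_ : ChartedSpace E3 X) (_ : IsManifold (𝓡 3) ∞ X) (_ : T2Space X)
    (_ : SecondCountableTopology X) (_ : ConnectedSpace X) (dstar : InitialDataSet (𝓡 3) X),
    dstar ∈ admissibleVacuumData X ∧ LocallyIncurable dstar ∧ TameGoodExit dstar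

/-- **Negation frame (proved).** A locally incurable, tamely curable admissible datum refutes the crux:
at it the crux's hypotheses hold (`¬ Good`, tame good exit) and its conclusion fails (no local exit window). -/
theorem not_tameExitsLocalise_of_exists (h : ExistsIncurableTamelyCurable) : ¬ TameExitsLocalise := by
  obtain ⟨X, _, _, _, _, _, _, dstar, hd, hinc, hexit⟩ := h
  intro hB
  exact hinc.not_localExitWindow (hB X dstar hd (hinc.not_good hd) hexit)

/-- Conversely the crux forbids such data (contrapositive bookkeeping, proved). -/
theorem not_exists_of_tameExitsLocalise (hB : TameExitsLocalise) : ¬ ExistsIncurableTamelyCurable :=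
  fun h ↦ not_tameExitsLocalise_of_exists h hB

/-- **NL1 split, far-field half (census §Negation, pieces (α)+(γ)).** Some admissible datum is locally incurable AND
is the `wDist`-limit base of a tame immersed injective admissible family all of whose members `c ≠ 0` are
TAIL-SMOOTH (the shells beyond radius `~1/‖c‖` switched off). Provable-in-principle with present technology
(conformal method with locally finite TT source; small-data `H^{2+}` local theory near each focus; a slab-rigidity
lemma); no global evolution theorem is needed for THIS half. -/
def ExistsIncurableWithTameSmoothing : Prop :=
  ∃ (X : Type) (_ : TopologicalSpace X) (_ : ChartedSpace E3 X) (_ : IsManifold (𝓡 3) ∞ X) (_ : T2Space X)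
    (_ : SecondCountableTopology X) (_ : ConnectedSpace X) (dstar : InitialDataSet (𝓡 3) X)
    (e : AFEnd X) (F : EuclideanSpace ℝ (Fin 1) → InitialDataSet (𝓡 3) X),
    dstar ∈ admissibleVacuumData X ∧ LocallyIncurable dstar ∧
    InitialDataSet.IsTameDataFamily e 1 F ∧ InitialDataSet.IsImmersedAtZero 1 F ∧ F 0 = dstar ∧
    Function.Injective F ∧ (∀ c, F c ∈ admissibleVacuumData X) ∧ ∀ c, c ≠ 0 → TailSmooth e (F c)

/-- **NL1 split, evolution half (census §Negation, piece (β)) — in the abstract form the frame needs.** Along the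
family of the previous def the tail-smooth members are good. In the intended instance this is "Minkowski space plus
finitely many admissible geometric-optics shells plus a small compactly supported TT wiggle has complete `𝓘⁺` and
settles (`N = 0`)": immediate physics, print-open mathematics (the members are large in every weighted `H^s`,
`s ≥ 4`, so Christodoulou–Klainerman / Bieri / Lindblad–Rodnianski do not apply as stated). Stated here only as the
implication between the two typed halves. -/
def TameSmoothingMembersGood : Prop :=
  ∀ (X : Type) [TopologicalSpace X] [ChartedSpace E3 X] [IsManifold (𝓡 3) ∞ X] [T2Space X]
    [SecondCountableTopology X] [ConnectedSpace X] (dstar : InitialDataSet (𝓡 3) X)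
    (e : AFEnd X) (F : EuclideanSpace ℝ (Fin 1) → InitialDataSet (𝓡 3) X),
    dstar ∈ admissibleVacuumData X → LocallyIncurable dstar →
    InitialDataSet.IsTameDataFamily e 1 F → InitialDataSet.IsImmersedAtZero 1 F → F 0 = dstar →
    Function.Injective F → (∀ c, F c ∈ admissibleVacuumData X) → (∀ c, c ≠ 0 → TailSmooth e (F c)) →
    ∃ F₁ : EuclideanSpace ℝ (Fin 1) → InitialDataSet (𝓡 3) X,
      InitialDataSet.IsTameDataFamily e 1 F₁ ∧ InitialDataSet.IsImmersedAtZero 1 F₁ ∧ F₁ 0 = dstar ∧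
      Function.Injective F₁ ∧ (∀ c, F₁ c ∈ admissibleVacuumData X) ∧ ∀ c, c ≠ 0 → Good (F₁ c)

/-- The two halves give NL1 (proved). -/
theorem existsIncurableTamelyCurable_of (h₁ : ExistsIncurableWithTameSmoothing)
    (h₂ : TameSmoothingMembersGood) : ExistsIncurableTamelyCurable := by
  obtain ⟨X, i₁, i₂, i₃, i₄, i₅, i₆, dstar, e, F, hd, hinc, hF, himm, h0, hinj, hadm, hsm⟩ := h₁
  obtain ⟨F₁, hF₁, himm₁, h0₁, hinj₁, hadm₁, hgood₁⟩ := h₂ X dstar e F hd hinc hF himm h0 hinj hadm hsm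
  exact ⟨X, i₁, i₂, i₃, i₄, i₅, i₆, dstar, hd, hinc, e, F₁, hF₁, himm₁, h0₁, hinj₁, hadm₁, hgood₁⟩

/-- Hence the two halves refute the crux (proved). -/
theorem not_tameExitsLocalise_of_halves (h₁ : ExistsIncurableWithTameSmoothing)
    (h₂ : TameSmoothingMembersGood) : ¬ TameExitsLocalise :=
  not_tameExitsLocalise_of_exists (existsIncurableTamelyCurable_of h₁ h₂)

/-! ## §3 Route-repair candidates (for the route's planner; signatures, with the cheap comparisons proved) -/

/-- **B_smooth — the crux restricted to TAIL-SMOOTH base data** (candidate minimal restatement: the far-field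
artefact class is excluded by hypothesis; the lamination datum of crux A would have to be produced tail-smooth). -/
def TameExitsLocaliseSmooth : Prop :=
  ∀ (X : Type) [TopologicalSpace X] [ChartedSpace E3 X] [IsManifold (𝓡 3) ∞ X] [T2Space X]
    [SecondCountableTopology X] [ConnectedSpace X],
    ∀ dstar ∈ admissibleVacuumData X, (∃ e : AFEnd X, TailSmooth e dstar) →
      ¬ Good dstar → TameGoodExit dstar → LocalExitWindow dstar

/-- **B_rough — the crux on the complementary class** (where the geometric-optics datum lives: the refuter's half). -/
def TameExitsLocaliseRough : Prop :=
  ∀ (X : Type) [TopologicalSpace X] [ChartedSpace E3 X] [IsManifold (𝓡 3) ∞ X] [T2Space X]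
    [SecondCountableTopology X] [ConnectedSpace X],
    ∀ dstar ∈ admissibleVacuumData X, ¬ (∃ e : AFEnd X, TailSmooth e dstar) →
      ¬ Good dstar → TameGoodExit dstar → LocalExitWindow dstar

/-- The case split (proved): `B_smooth → B_rough → B`. -/
theorem tameExitsLocalise_of_smooth_rough (hs : TameExitsLocaliseSmooth) (hr : TameExitsLocaliseRough) :
    TameExitsLocalise := by
  intro X _ _ _ _ _ _ dstar hd hbad hexit
  by_cases htail : ∃ e : AFEnd X, TailSmooth e dstar
  · exact hs X dstar hd htail hbad hexit
  · exact hr X dstar hd htail hbad hexit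

/-- Both halves are special cases of the crux (proved). -/
theorem smooth_of_tameExitsLocalise (hB : TameExitsLocalise) : TameExitsLocaliseSmooth :=
  fun X _ _ _ _ _ _ dstar hd _ hbad hexit ↦ hB X dstar hd hbad hexit

theorem rough_of_tameExitsLocalise (hB : TameExitsLocalise) : TameExitsLocaliseRough :=
  fun X _ _ _ _ _ _ dstar hd _ hbad hexit ↦ hB X dstar hd hbad hexit

/-- **S⁺ = S_loc — local genericity on a window, outright** (the strengthening that drops the tame-exit
hypothesis). Refuted inside the route's own world by crux A (refuter's `not_localKickGeneric_of_laminatedThreshold`)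
and, absolutely, by any locally incurable admissible datum (`not_localGenericWindow_of_incurable`). -/
def LocalGenericWindow : Prop :=
  ∀ (X : Type) [TopologicalSpace X] [ChartedSpace E3 X] [IsManifold (𝓡 3) ∞ X] [T2Space X]
    [SecondCountableTopology X] [ConnectedSpace X],
    ∀ dstar ∈ admissibleVacuumData X, ¬ Good dstar → LocalExitWindow dstar

/-- `S_loc → B` (proved; the refuter's `tameExitsLocalise_of_localKickGeneric`). -/
theorem tameExitsLocalise_of_localGenericWindow (h : LocalGenericWindow) : TameExitsLocalise :=
  fun X _ _ _ _ _ _ dstar hd hbad _ ↦ h X dstar hd hbad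

/-- A locally incurable admissible datum refutes `S_loc` (proved). -/
theorem not_localGenericWindow_of_incurable {X : Type} [TopologicalSpace X] [ChartedSpace E3 X]
    [IsManifold (𝓡 3) ∞ X] [T2Space X] [SecondCountableTopology X] [ConnectedSpace X]
    {dstar : InitialDataSet (𝓡 3) X} (hd : dstar ∈ admissibleVacuumData X) (h : LocallyIncurable dstar) :
    ¬ LocalGenericWindow :=
  fun hS ↦ h.not_localExitWindow (hS X dstar hd (h.not_good hd))

/-- **B_CS — the crux transferred to the Corvino–Schoen class with FLOATING Kerr tails** (candidate structural
restatement). For a Kerr-ended admissible exceptional `d⋆` with a tame good exit there is a jointly smooth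
admissible family through `d⋆`, all of whose members are EXACT KERR LEAVES OFF ONE COMPACT SET `K` (Kerr
parameters, chart and leaf may depend on `c`), good on a punctured window. Floating parameters dissolve the KID
charge obstruction of annular gluing onto the exact tail of `d⋆` (birth line, stub S3); exact Kerr tails exclude every
far-field artefact. The matching crux A must then saturate along such families (closes' lamination lemma is
unchanged). -/
def TameExitsLocaliseKerrEnded : Prop :=
  ∀ (X : Type) [TopologicalSpace X] [ChartedSpace E3 X] [IsManifold (𝓡 3) ∞ X] [T2Space X]
    [SecondCountableTopology X] [ConnectedSpace X],
    ∀ dstar ∈ admissibleVacuumData X, dstar.HasExactKerrEnd → ¬ Good dstar → TameGoodExit dstar →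
      ∃ F' : EuclideanSpace ℝ (Fin 1) → InitialDataSet (𝓡 3) X,
        InitialDataSet.IsSmoothDataFamily 1 F' ∧ F' 0 = dstar ∧ (∀ c, F' c ∈ admissibleVacuumData X) ∧
        (∀ [Kerr.Facts], ∃ K : Set X, IsCompact K ∧ ∀ c, ∃ (U : TopologicalSpace.Opens E3) (M a r₀ : ℝ)
          (hM : 0 ≤ M) (φ : U → X) (ψ : U → Kerr.region a r₀) (ν : NormalField 𝓘(ℝ, E4) ψ),
          (F' c).IsExactKerrEndAlong K U M a r₀ hM φ ψ ν) ∧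
        ∃ ε : ℝ, 0 < ε ∧ ∀ c, c ≠ 0 → ‖c‖ < ε → Good (F' c)

/-- **B ⇒ B_CS (proved): the Corvino–Schoen form is a WEAKENING of the crux** — a local exit `F' c = d⋆` off `C`
through a datum which is an exact Kerr leaf off `K` consists of exact Kerr leaves off `K ∪ C`
(`IsExactKerrEndAlong.of_eq_off_compact`), with the SAME parameters; B_CS merely allows them to float. -/
theorem kerrEnded_of_tameExitsLocalise (hB : TameExitsLocalise) : TameExitsLocaliseKerrEnded := by
  intro X _ _ _ _ _ _ dstar hd hKerr hbad hexit
  obtain ⟨F', hF', -, h0, -, hadm, ⟨C, hC, hagree⟩, ε, hε, hgood⟩ := hB X dstar hd hbad hexit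
  refine ⟨F', hF', h0, hadm, ?_, ε, hε, hgood⟩
  intro _
  obtain ⟨K, U, M, a, r₀, hM, φ, ψ, ν, hK⟩ := hKerr.exists
  refine ⟨K ∪ C, hK.1.union hC, fun c ↦ ⟨U, M, a, r₀, hM, φ, ψ, ν, ?_⟩⟩
  exact hK.of_eq_off_compact hC (fun x hx ↦ (hagree c x hx).1) fun x hx ↦ (hagree c x hx).2

end Summit.FinalStateConjecture.FinalStateConjecture.Cruxes.TameExitsLocalise.Strategist

end
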